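import Literature.Geometry.Lorentzian.KerrPeel
import HarnessLib

/-!
# The outgoing escape field of a sub-extremal Kerr exterior and the outgoing causal leg

Kerr–Schild ("star") chart `(t*, x, y, z)` of Kerr with `0 < M`, any real `a` (Visser arXiv:0706.0622,
(32)–(35); O'Neill 1995, §2.5 for `Δ = r² − 2Mr + a²`, `Σ`, `r±`).  With `V = −g♯dt*`
(`Kerr.timeVector`, `g(V,V) = −1 − 2H`) and `W = g♯dr` (`Kerr.radiusGradVector`), the **escape field**
is `w = s V + W` with slope `s = 3Δ/(8Mr)` (`escapeSlope`, `escapeVector`):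

* §1 algebra: `w⁰ = s(1 + 2H) + 2H`, `g(V, w) = −w⁰`, `2Hs = 3Δ/(4Σ)`, `dr(w) = g(W, w) = Δ/(4Σ)`,
  `g(w, w) = −(1 + 2H)s² − Δ/(2Σ)`; on the shell `r₊ + δ ≤ r ≤ R₀` (`M, δ > 0`): `Δ ≥ δ²`, `r > 0`,
  and the uniform SHELL BOUNDS `−g(w,w) ≥ δ²/(2(2R₀² + a²))`, `dr(w) ≥ δ²/(4(2R₀² + a²))`,
  `w⁰ ≥ 3δ²/(8 M R₀)`, `g(V,V) ≤ −1`, `g(V,w) ≤ −3δ²/(8MR₀)` (`shell_bounds`);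
* §2–§4 time normalisation `x ↦ (0, x⃗)` (the data are `t*`-independent; the bookkeeping `tn`,
  `*_tn`, continuity and operator-norm lemmas are those of `KerrPeel`, imported, not re-declared),
  the compact shells `shell M a δ R₀ = {x⁰ = 0, r₊ + δ ≤ r ≤ R₀}` and
  `shell' = B̄(0, R₀ + |a| + 1) ∩ {r ≥ r₊ + δ/2}`;
* §5 `rest_package`: uniform rest-frame constants `m₀, m₂, c₁ > 0`, `C_w, C_V ≥ 1`, `ℓ > 0` on the
  shell (uniform continuity of the Kerr–Schild data on the compact thickened shell);
* §6 the chart legs in a time-oriented `Spacetime 4` on a boosted Kerr–Schild background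
  (`boostedKerrBackground Λ c M a`): `outgoingEscape_spacetime` — for `M, δ > 0`, `R₀ ≥ r₊ + δ`
  there are `ε > 0` and `C` such that, if the metric deviation `‖Ψ^*g − g_B‖` is `≤ ε` on
  `{t* ≥ τ₁, r ≤ R₀ + 1}` and `dΨ(ΛV)` is future-directed there, every chart point `y` with
  `t*(y) ≥ τ₁`, `r₊ + δ ≤ r(y) ≤ R₀` is joined by a future causal curve to a chart point `x` with
  `r(x) = R₀`, `t*(y) ≤ t*(x) ≤ t*(y) + C` (the straight chart segment along `Λw` is `g`-timelike and
  future-directed by the one-sign lemma; O'Neill 1983, Ch. 5, Lemma 5.26; Ch. 14, p. 402;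
  far/near-zone cones of Kerr: Dafermos–Rodnianski arXiv:0811.0354, §5.1).

Provenance: decomp-fsc lens-3 side file `HLine37Composed.lean`, span `namespace
Literature.Geometry.Lorentzian.KerrEscape` (the OE30 engine behind the route's `outgoingEscapes_holds`),
re-homed verbatim up to (i) deletion of the helpers already landed in `KerrPeel` (used by qualified
name), (ii) docstrings / cite tags.  NOT here: the route-side port `OutgoingEscape` / `outgoingEscapes_holds`
over `VacuumCauchyDevelopment` and the `Description` carrier — route side.
-/

noncomputable section

open scoped Manifold ContDiff Topology
open Filter Set Metric

namespace Literature.Geometry.Lorentzian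

namespace KerrEscape

-- typeclass search through nested operator types `E4 →L[ℝ] E4 →L[ℝ] ℝ`
set_option maxSynthPendingDepth 3

/-! ## §1 The escape field: algebra -/

/-- `Δ = r² − 2Mr + a²` as a function on the Kerr–Schild chart. [cite: ONeill1995, §2.5] -/
def blDelta (M a : ℝ) (x : E4) : ℝ :=
  Kerr.radius a x ^ 2 - 2 * M * Kerr.radius a x + a ^ 2

/-- The slope `s = 3Δ/(8Mr)` of the escape field (`Δ = r² − 2Mr + a²`). [cite: ONeill1995, §2.5] -/
def escapeSlope (M a : ℝ) (x : E4) : ℝ :=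
  3 * blDelta M a x / (8 * M * Kerr.radius a x)

/-- **The escape field** `w = s V + W` on the Kerr–Schild chart (`V = −g♯dt*` = `Kerr.timeVector`,
`W = g♯dr` = `Kerr.radiusGradVector`, `s = escapeSlope`): an outgoing (`dr(w) > 0`) timelike direction
transverse to the level sets of `r` outside the horizon.  Dafermos–Rodnianski arXiv:0811.0354, §5.1
(Kerr–Schild star coordinates, `∂_{t*}` and `∇r`). [cite: arXiv08110354, §5.1] -/
def escapeVector (M a : ℝ) (x : E4) : E4 :=
  escapeSlope M a x • Kerr.timeVector M a x + Kerr.radiusGradVector M a x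

variable {M a : ℝ} {x : E4}

/-- `w⁰ = s(1 + 2H) + 2H` (`V⁰ = 1 + 2H`, `W⁰ = 2H`). [cite: arXiv08110354, §5.1] -/
theorem escapeVector_apply_zero (M a : ℝ) (x : E4) :
    escapeVector M a x 0 =
      escapeSlope M a x * (1 + 2 * Kerr.scalarH M a x) + 2 * Kerr.scalarH M a x := by
  simp [escapeVector, Kerr.timeVector, Kerr.nullVector_apply_zero, Kerr.radiusGradVector_apply_zero]

/-- `g(V, w) = −w⁰`. [cite: arXiv08110354, §5.1] -/
theorem bilin_timeVector_escapeVector (hx : 0 < Kerr.radius a x) :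
    Kerr.bilin M a x (Kerr.timeVector M a x) (escapeVector M a x) = -(escapeVector M a x 0) :=
  Kerr.bilin_timeVector hx _

/-- `2Hs = 3Δ/(4Σ)` (`HΣ = Mr`). [cite: arXiv07060622, (33)] -/
theorem two_mul_scalarH_mul_escapeSlope (hM : M ≠ 0) (hx : 0 < Kerr.radius a x) :
    2 * Kerr.scalarH M a x * escapeSlope M a x =
      3 * blDelta M a x / (4 * Kerr.blSigma a (E4.spatial x)) := by
  rw [Kerr.scalarH_eq_div_blSigma M a hx, escapeSlope]
  have hS := (Kerr.blSigma_spatial_pos hx).ne'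
  have hr := hx.ne'
  field_simp
  ring

/-- **`dr(w) = g(W, w) = Δ/(4Σ)`.** [cite: ONeill1995, §2.5] -/
theorem bilin_radiusGradVector_escapeVector (hM : M ≠ 0) (hx : 0 < Kerr.radius a x) :
    Kerr.bilin M a x (Kerr.radiusGradVector M a x) (escapeVector M a x) =
      blDelta M a x / (4 * Kerr.blSigma a (E4.spatial x)) := by
  have h1 : Kerr.bilin M a x (Kerr.radiusGradVector M a x) (Kerr.timeVector M a x) =
      -(2 * Kerr.scalarH M a x) := by
    rw [Kerr.bilin_symm, Kerr.bilin_timeVector_radiusGradVector hx]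
  have h2 := two_mul_scalarH_mul_escapeSlope hM hx
  rw [escapeVector, map_add, map_smul, smul_eq_mul, h1, Kerr.bilin_radiusGradVector_self hx]
  rw [show Kerr.radius a x ^ 2 - 2 * M * Kerr.radius a x + a ^ 2 = blDelta M a x from rfl]
  linear_combination (-1 : ℝ) * h2

/-- **`g(w, w) = −(1 + 2H)s² − Δ/(2Σ)`.** [cite: ONeill1995, §2.5] -/
theorem bilin_escapeVector_self (hM : M ≠ 0) (hx : 0 < Kerr.radius a x) :
    Kerr.bilin M a x (escapeVector M a x) (escapeVector M a x) =
      -(1 + 2 * Kerr.scalarH M a x) * escapeSlope M a x ^ 2 -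
        blDelta M a x / (2 * Kerr.blSigma a (E4.spatial x)) := by
  have h1 : Kerr.bilin M a x (Kerr.radiusGradVector M a x) (Kerr.timeVector M a x) =
      -(2 * Kerr.scalarH M a x) := by
    rw [Kerr.bilin_symm, Kerr.bilin_timeVector_radiusGradVector hx]
  have h2 := two_mul_scalarH_mul_escapeSlope hM hx
  rw [escapeVector]
  simp only [map_add, map_smul, smul_eq_mul, add_apply, smul_apply]
  rw [Kerr.bilin_timeVector_timeVector hx, Kerr.bilin_timeVector_radiusGradVector hx, h1,
    Kerr.bilin_radiusGradVector_self hx]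
  rw [show Kerr.radius a x ^ 2 - 2 * M * Kerr.radius a x + a ^ 2 = blDelta M a x from rfl]
  linear_combination (-2 : ℝ) * h2

/-- **`Δ ≥ δ²` on `{r ≥ r₊ + δ}`** (all real `a`; for `|a| > M`, `r₊ = M`). [cite: ONeill1995, §2.5] -/
theorem sq_le_blDelta {δ : ℝ} (hδ : 0 ≤ δ) (hr : Kerr.rPlus M a + δ ≤ Kerr.radius a x) :
    δ ^ 2 ≤ blDelta M a x := by
  unfold blDelta
  unfold Kerr.rPlus at hr
  set r := Kerr.radius a x with hrdef
  set S := √(M ^ 2 - a ^ 2) with hSdef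
  have hS0 : 0 ≤ S := Real.sqrt_nonneg _
  rcases le_or_gt 0 (M ^ 2 - a ^ 2) with h | h
  · have hS2 : S ^ 2 = M ^ 2 - a ^ 2 := Real.sq_sqrt h
    nlinarith
  · have hS : S = 0 := Real.sqrt_eq_zero'.mpr h.le
    rw [hS] at hr
    nlinarith

/-- `r > 0` on `{r ≥ r₊ + δ}` for `M > 0`, `δ ≥ 0`. [cite: ONeill1995, §2.5] -/
theorem radius_pos_of_le (hM : 0 < M) {δ : ℝ} (hδ : 0 ≤ δ)
    (hr : Kerr.rPlus M a + δ ≤ Kerr.radius a x) : 0 < Kerr.radius a x := by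
  have := KerrPeel.le_rPlus M a
  linarith

/-- `max r₊ 0 < r` on `{r ≥ r₊ + δ}` for `M > 0`, `δ > 0` (membership in `Kerr.exterior`). [cite: ONeill1995, §2.5] -/
theorem max_rPlus_lt_of_le (hM : 0 < M) {δ : ℝ} (hδ : 0 < δ)
    (hr : Kerr.rPlus M a + δ ≤ Kerr.radius a x) : max (Kerr.rPlus M a) 0 < Kerr.radius a x := by
  have := KerrPeel.le_rPlus M a
  exact max_lt (by linarith) (by linarith)

/-- **Shell bounds.** On `r₊ + δ ≤ r ≤ R₀` (`M, δ > 0`): `−g(w,w) ≥ δ²/(2(2R₀² + a²))`,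
`dr(w) ≥ δ²/(4(2R₀² + a²))`, `w⁰ ≥ 3δ²/(8 M R₀)`, `g(V,V) ≤ −1`, `g(V,w) = −w⁰`. [cite: ONeill1995, §2.5] -/
theorem shell_bounds (hM : 0 < M) {δ R₀ : ℝ} (hδ : 0 < δ)
    (hr : Kerr.rPlus M a + δ ≤ Kerr.radius a x) (hR : Kerr.radius a x ≤ R₀) :
    Kerr.bilin M a x (escapeVector M a x) (escapeVector M a x) ≤ -(δ ^ 2 / (2 * (2 * R₀ ^ 2 + a ^ 2))) ∧
    δ ^ 2 / (4 * (2 * R₀ ^ 2 + a ^ 2)) ≤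
      Kerr.bilin M a x (Kerr.radiusGradVector M a x) (escapeVector M a x) ∧
    3 * δ ^ 2 / (8 * M * R₀) ≤ escapeVector M a x 0 ∧
    Kerr.bilin M a x (Kerr.timeVector M a x) (Kerr.timeVector M a x) ≤ -1 ∧
    Kerr.bilin M a x (Kerr.timeVector M a x) (escapeVector M a x) = -(escapeVector M a x 0) := by
  have hr0 : 0 < Kerr.radius a x := radius_pos_of_le hM hδ.le hr
  have hD : δ ^ 2 ≤ blDelta M a x := sq_le_blDelta hδ.le hr
  have hδ2 : 0 < δ ^ 2 := by positivity
  have hD0 : 0 < blDelta M a x := lt_of_lt_of_le hδ2 hD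
  have hS0 : 0 < Kerr.blSigma a (E4.spatial x) := Kerr.blSigma_spatial_pos hr0
  have hSle : Kerr.blSigma a (E4.spatial x) ≤ 2 * R₀ ^ 2 + a ^ 2 := by
    have h := KerrPeel.blSigma_spatial_le a x
    have : Kerr.radius a x ^ 2 ≤ R₀ ^ 2 := pow_le_pow_left₀ hr0.le hR 2
    linarith
  have hH0 : 0 ≤ Kerr.scalarH M a x := Kerr.scalarH_nonneg hM.le a x
  have hR0 : 0 < R₀ := lt_of_lt_of_le hr0 hR
  have hT0 : 0 < 2 * R₀ ^ 2 + a ^ 2 := by positivity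
  have hs0 : 0 < escapeSlope M a x := by
    unfold escapeSlope
    positivity
  refine ⟨?_, ?_, ?_, ?_, bilin_timeVector_escapeVector hr0⟩
  · rw [bilin_escapeVector_self hM.ne' hr0]
    have h1 : δ ^ 2 / (2 * (2 * R₀ ^ 2 + a ^ 2)) ≤ blDelta M a x / (2 * Kerr.blSigma a (E4.spatial x)) := by
      rw [div_le_div_iff₀ (by positivity) (by positivity)]
      nlinarith
    have h2 : 0 ≤ (1 + 2 * Kerr.scalarH M a x) * escapeSlope M a x ^ 2 := by positivity
    nlinarith
  · rw [bilin_radiusGradVector_escapeVector hM.ne' hr0]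
    rw [div_le_div_iff₀ (by positivity) (by positivity)]
    nlinarith
  · rw [escapeVector_apply_zero]
    have h1 : 3 * δ ^ 2 / (8 * M * R₀) ≤ escapeSlope M a x := by
      unfold escapeSlope
      rw [div_le_div_iff₀ (by positivity) (by positivity)]
      calc 3 * δ ^ 2 * (8 * M * Kerr.radius a x) ≤ 3 * blDelta M a x * (8 * M * Kerr.radius a x) := by
            gcongr
        _ ≤ 3 * blDelta M a x * (8 * M * R₀) := by gcongr
    nlinarith
  · rw [Kerr.bilin_timeVector_timeVector hr0]
    linarith

/-! ## §2 Time normalisation `x ↦ (0, x⃗)` (the Kerr–Schild data are `t*`-independent) -/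

/-- `Δ` is `t*`-independent. [cite: ONeill1995, §2.5] -/
theorem blDelta_tn (M a : ℝ) (x : E4) : blDelta M a (KerrPeel.tn x) = blDelta M a x := by
  unfold blDelta; rw [KerrPeel.radius_tn]

/-- The slope `s` is `t*`-independent. [cite: ONeill1995, §2.5] -/
theorem escapeSlope_tn (M a : ℝ) (x : E4) : escapeSlope M a (KerrPeel.tn x) = escapeSlope M a x := by
  unfold escapeSlope; rw [blDelta_tn, KerrPeel.radius_tn]

/-- The escape field is `t*`-independent. [cite: arXiv08110354, §5.1] -/
theorem escapeVector_tn (M a : ℝ) (x : E4) : escapeVector M a (KerrPeel.tn x) = escapeVector M a x := by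
  unfold escapeVector; rw [escapeSlope_tn, KerrPeel.timeVector_tn, KerrPeel.radiusGradVector_tn]

/-! ## §3 Continuity of the Kerr–Schild data wherever `r > 0` -/

/-- The slope `s` is continuous wherever `r > 0` (`M ≠ 0`). [cite: ONeill1995, §2.5] -/
theorem continuousAt_escapeSlope (hM : M ≠ 0) (a : ℝ) (hx : 0 < Kerr.radius a x) :
    ContinuousAt (escapeSlope M a) x := by
  have hr := Kerr.continuous_radius a
  have hn : Continuous fun x : E4 => 3 * (Kerr.radius a x ^ 2 - 2 * M * Kerr.radius a x + a ^ 2) :=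
    continuous_const.mul (((hr.pow 2).sub (continuous_const.mul hr)).add continuous_const)
  have hd : Continuous fun x : E4 => 8 * M * Kerr.radius a x := continuous_const.mul hr
  have hne : 8 * M * Kerr.radius a x ≠ 0 := mul_ne_zero (mul_ne_zero (by norm_num) hM) hx.ne'
  exact hn.continuousAt.div hd.continuousAt hne

/-- The escape field is continuous wherever `r > 0` (`M ≠ 0`). [cite: arXiv08110354, §5.1] -/
theorem continuousAt_escapeVector (hM : M ≠ 0) (a : ℝ) (hx : 0 < Kerr.radius a x) :
    ContinuousAt (escapeVector M a) x := by
  unfold escapeVector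
  exact ((continuousAt_escapeSlope hM a hx).smul (KerrPeel.continuousAt_timeVector M a hx)).add
    (KerrPeel.continuousAt_radiusGradVector M a hx)

/-! ## §4 The compact shells -/

/-- The time-normalised closed shell `K = {x⁰ = 0, r₊ + δ ≤ r ≤ R₀}`. [cite: arXiv08110354, §5.1] -/
def shell (M a δ R₀ : ℝ) : Set E4 :=
  {x | x 0 = 0 ∧ Kerr.rPlus M a + δ ≤ Kerr.radius a x ∧ Kerr.radius a x ≤ R₀}

/-- The shell `{x⁰ = 0, r₊ + δ ≤ r ≤ R₀}` is closed (`r` is continuous). [cite: arXiv07060622, (35)] -/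
theorem isClosed_shell (M a δ R₀ : ℝ) : IsClosed (shell M a δ R₀) :=
  (isClosed_eq KerrPeel.continuous_apply_zero_E4 continuous_const).inter
    ((isClosed_le continuous_const (Kerr.continuous_radius a)).inter
      (isClosed_le (Kerr.continuous_radius a) continuous_const))

/-- Points of the shell have norm `≤ R₀ + |a|` (`|x⃗|² ≤ r² + a²`). [cite: arXiv07060622, (35)] -/
theorem norm_le_of_mem_shell {δ R₀ : ℝ} (hR₀ : 0 ≤ R₀) (hx : x ∈ shell M a δ R₀) :
    ‖x‖ ≤ R₀ + |a| := by
  have h := KerrPeel.norm_sq_le a x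
  rw [hx.1] at h
  have hr0 := Kerr.radius_nonneg a x
  have hr2 : Kerr.radius a x ^ 2 ≤ R₀ ^ 2 := pow_le_pow_left₀ hr0 hx.2.2 2
  have ha := abs_nonneg a
  have ha2 : a ^ 2 = |a| ^ 2 := (sq_abs a).symm
  have h2 : ‖x‖ ^ 2 ≤ (R₀ + |a|) ^ 2 := by nlinarith [mul_nonneg hR₀ ha]
  exact (pow_le_pow_iff_left₀ (norm_nonneg x) (by positivity) two_ne_zero).1 h2

/-- The shell `{x⁰ = 0, r₊ + δ ≤ r ≤ R₀}` is compact (closed and bounded by `R₀ + |a|`, `|x⃗|² ≤ r² + a²`). [cite: arXiv07060622, (35)] -/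
theorem isCompact_shell (M a : ℝ) {δ R₀ : ℝ} (hR₀ : 0 ≤ R₀) : IsCompact (shell M a δ R₀) :=
  (isCompact_closedBall (0 : E4) (R₀ + |a|)).of_isClosed_subset (isClosed_shell M a δ R₀)
    fun _ hx => mem_closedBall_zero_iff.2 (norm_le_of_mem_shell hR₀ hx)

/-- The thickened compact shell `K' = B̄(0, R₀ + |a| + 1) ∩ {r ≥ r₊ + δ/2}`. [cite: arXiv08110354, §5.1] -/
def shell' (M a δ R₀ : ℝ) : Set E4 :=
  closedBall (0 : E4) (R₀ + |a| + 1) ∩ {x | Kerr.rPlus M a + δ / 2 ≤ Kerr.radius a x}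

/-- The thickened shell `B̄(0, R₀ + |a| + 1) ∩ {r ≥ r₊ + δ/2}` is compact. [cite: arXiv07060622, (35)] -/
theorem isCompact_shell' (M a δ R₀ : ℝ) : IsCompact (shell' M a δ R₀) :=
  (isCompact_closedBall (0 : E4) (R₀ + |a| + 1)).inter_right
    (isClosed_le continuous_const (Kerr.continuous_radius a))

/-! ## §5 Rest-frame kinematics of the escape field: uniform constants on the shell -/

/-- **Rest-frame kinematics of the escape field.** For `M, δ > 0`, `R₀ ≥ r₊ + δ` there are
constants `m₀, m₂, c₁ > 0`, `C_w, C_V ≥ 1`, `ℓ > 0` such that at every point `p` of the shell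
`r₊ + δ ≤ r ≤ R₀` (any `t*`), with `w = escapeVector p`: `‖w‖ ≤ C_w`, `‖V‖ ≤ C_V`, `m₂ ≤ w⁰ ≤ C_w`,
`g(V,V) ≤ −1`, `g(V,w) ≤ −m₂`; along the frozen segment `p + θw`, `0 ≤ θ ≤ ℓ`: `r > 0`,
`g_{p+θw}(w,w) ≤ −m₀`, and the radius grows at rate `≥ c₁`. Uniform continuity of `x ↦ g_x`,
`x ↦ dr_x` on a compact shell (Heine–Cantor) and the mean value theorem. [cite: arXiv08110354, §5.1] -/
theorem rest_package (hM : 0 < M) (a : ℝ) {δ R₀ : ℝ} (hδ : 0 < δ)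
    (hR₀ : Kerr.rPlus M a + δ ≤ R₀) :
    ∃ m₀ m₂ c₁ Cw CV ℓ : ℝ, 0 < m₀ ∧ 0 < m₂ ∧ 0 < c₁ ∧ 1 ≤ Cw ∧ 1 ≤ CV ∧ 0 < ℓ ∧
    ∀ p : E4, Kerr.rPlus M a + δ ≤ Kerr.radius a p → Kerr.radius a p ≤ R₀ →
      ‖escapeVector M a p‖ ≤ Cw ∧ ‖Kerr.timeVector M a p‖ ≤ CV ∧
      m₂ ≤ escapeVector M a p 0 ∧ escapeVector M a p 0 ≤ Cw ∧
      Kerr.bilin M a p (Kerr.timeVector M a p) (Kerr.timeVector M a p) ≤ -1 ∧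
      Kerr.bilin M a p (Kerr.timeVector M a p) (escapeVector M a p) ≤ -m₂ ∧
      (∀ θ ∈ Icc (0 : ℝ) ℓ,
        0 < Kerr.radius a (p + θ • escapeVector M a p) ∧
        Kerr.bilin M a (p + θ • escapeVector M a p) (escapeVector M a p) (escapeVector M a p) ≤ -m₀) ∧
      (∀ θ ∈ Icc (0 : ℝ) ℓ, ∀ θ' ∈ Icc (0 : ℝ) ℓ, θ ≤ θ' →
        c₁ * (θ' - θ) ≤ Kerr.radius a (p + θ' • escapeVector M a p) -
          Kerr.radius a (p + θ • escapeVector M a p)) := by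
  have hrp : M ≤ Kerr.rPlus M a := KerrPeel.le_rPlus M a
  have hR0 : 0 < R₀ := by linarith
  -- the compact time-normalised shell and the bounds `Cw`, `CV`
  have hK : IsCompact (shell M a δ R₀) := isCompact_shell M a hR0.le
  have hKpos : ∀ x ∈ shell M a δ R₀, 0 < Kerr.radius a x :=
    fun x hx => radius_pos_of_le hM hδ.le hx.2.1
  obtain ⟨C1, hC1⟩ := hK.exists_bound_of_continuousOn (f := escapeVector M a)
    (fun x hx => (continuousAt_escapeVector hM.ne' a (hKpos x hx)).continuousWithinAt)
  obtain ⟨C2, hC2⟩ := hK.exists_bound_of_continuousOn (f := Kerr.timeVector M a)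
    (fun x hx => (KerrPeel.continuousAt_timeVector M a (hKpos x hx)).continuousWithinAt)
  set Cw : ℝ := max C1 1 with hCw
  set CV : ℝ := max C2 1 with hCV
  have hCw1 : 1 ≤ Cw := le_max_right _ _
  have hCV1 : 1 ≤ CV := le_max_right _ _
  have hCw0 : 0 < Cw := lt_of_lt_of_le one_pos hCw1
  -- explicit shell constants
  set T : ℝ := 2 * R₀ ^ 2 + a ^ 2 with hT
  have hT0 : 0 < T := by positivity
  set m₀' : ℝ := δ ^ 2 / (2 * T) with hm₀'
  set c₁' : ℝ := δ ^ 2 / (4 * T) with hc₁'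
  set m₂ : ℝ := 3 * δ ^ 2 / (8 * M * R₀) with hm₂
  have hm₀'0 : 0 < m₀' := by positivity
  have hc₁'0 : 0 < c₁' := by positivity
  have hm₂0 : 0 < m₂ := by positivity
  -- uniform continuity of the radius on a big ball
  set RK : ℝ := R₀ + |a| with hRK
  have hball : IsCompact (closedBall (0 : E4) (RK + 1)) := isCompact_closedBall _ _
  have hucr : UniformContinuousOn (Kerr.radius a) (closedBall (0 : E4) (RK + 1)) :=
    hball.uniformContinuousOn_of_continuous (Kerr.continuous_radius a).continuousOn
  obtain ⟨ρ₀, hρ₀, hρ₀'⟩ := Metric.uniformContinuousOn_iff.1 hucr (δ / 2) (by positivity)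
  -- uniform continuity of `x ↦ g_x` and `x ↦ dr_x` on the thickened shell
  have hK' : IsCompact (shell' M a δ R₀) := isCompact_shell' M a δ R₀
  have hK'pos : ∀ x ∈ shell' M a δ R₀, 0 < Kerr.radius a x := by
    intro x hx
    have h2 : Kerr.rPlus M a + δ / 2 ≤ Kerr.radius a x := hx.2
    linarith
  have hucG : UniformContinuousOn (Kerr.bilin M a) (shell' M a δ R₀) :=
    hK'.uniformContinuousOn_of_continuous
      (fun x hx => (KerrPeel.continuousAt_bilin M a (hK'pos x hx)).continuousWithinAt)
  obtain ⟨ρ₁, hρ₁, hρ₁'⟩ := Metric.uniformContinuousOn_iff.1 hucG (m₀' / (2 * Cw ^ 2)) (by positivity)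
  have hucF : UniformContinuousOn (fun x : E4 => Kerr.bilin M a x (Kerr.radiusGradVector M a x))
      (shell' M a δ R₀) :=
    hK'.uniformContinuousOn_of_continuous
      (fun x hx => (KerrPeel.continuousAt_radiusDeriv M a (hK'pos x hx)).continuousWithinAt)
  obtain ⟨ρ₂, hρ₂, hρ₂'⟩ := Metric.uniformContinuousOn_iff.1 hucF (c₁' / (2 * Cw)) (by positivity)
  -- the step length
  set ρ : ℝ := min 1 (min ρ₀ (min ρ₁ ρ₂)) with hρ
  have hρpos : 0 < ρ := lt_min one_pos (lt_min hρ₀ (lt_min hρ₁ hρ₂))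
  have hρ1 : ρ ≤ 1 := min_le_left _ _
  have hρρ₀ : ρ ≤ ρ₀ := (min_le_right _ _).trans (min_le_left _ _)
  have hρρ₁ : ρ ≤ ρ₁ := (min_le_right _ _).trans ((min_le_right _ _).trans (min_le_left _ _))
  have hρρ₂ : ρ ≤ ρ₂ := (min_le_right _ _).trans ((min_le_right _ _).trans (min_le_right _ _))
  set ℓ : ℝ := ρ / (2 * Cw) with hℓ
  have hℓ0 : 0 < ℓ := by positivity
  have hℓCw : ℓ * Cw = ρ / 2 := by
    rw [hℓ]
    field_simp
  refine ⟨m₀' / 2, m₂, c₁' / 2, Cw, CV, ℓ, by positivity, hm₂0, by positivity, hCw1, hCV1, hℓ0, ?_⟩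
  intro p hp1 hp2
  have hp0 : 0 < Kerr.radius a p := radius_pos_of_le hM hδ.le hp1
  -- the normalised point lies in the shell
  have hpK : KerrPeel.tn p ∈ shell M a δ R₀ :=
    ⟨KerrPeel.tn_apply_zero p, by rw [KerrPeel.radius_tn]; exact hp1, by rw [KerrPeel.radius_tn]; exact hp2⟩
  set v : E4 := escapeVector M a p with hvdef
  have hvK : ‖v‖ ≤ Cw := by
    have h := hC1 (KerrPeel.tn p) hpK
    rw [escapeVector_tn] at h
    exact h.trans (le_max_left _ _)
  have hVK : ‖Kerr.timeVector M a p‖ ≤ CV := by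
    have h := hC2 (KerrPeel.tn p) hpK
    rw [KerrPeel.timeVector_tn] at h
    exact h.trans (le_max_left _ _)
  obtain ⟨hb1, hb2, hb3, hb4, hb5⟩ := shell_bounds hM hδ hp1 hp2
  have hv0 : v 0 ≤ Cw := (le_abs_self _).trans ((KerrPeel.abs_apply_le_norm v 0).trans hvK)
  have hVw : Kerr.bilin M a p (Kerr.timeVector M a p) v ≤ -m₂ := by
    rw [hvdef, hb5]
    exact neg_le_neg hb3
  -- the normalised point lies in the big ball and in the thickened shell
  have hnp : ‖KerrPeel.tn p‖ ≤ RK := norm_le_of_mem_shell hR0.le hpK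
  have hp_ball : KerrPeel.tn p ∈ closedBall (0 : E4) (RK + 1) :=
    mem_closedBall_zero_iff.2 (by linarith)
  have hpK' : KerrPeel.tn p ∈ shell' M a δ R₀ := ⟨hp_ball, by
    show Kerr.rPlus M a + δ / 2 ≤ Kerr.radius a (KerrPeel.tn p)
    rw [KerrPeel.radius_tn]; linarith⟩
  -- along the frozen segment: the normalised points stay `ρ`-close and in the thickened shell
  have seg : ∀ θ ∈ Icc (0 : ℝ) ℓ,
      KerrPeel.tn (p + θ • v) ∈ shell' M a δ R₀ ∧ dist (KerrPeel.tn (p + θ • v)) (KerrPeel.tn p) < ρ := by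
    intro θ hθ
    have hθv : θ * ‖KerrPeel.tn v‖ ≤ ρ / 2 :=
      calc θ * ‖KerrPeel.tn v‖ ≤ ℓ * Cw :=
            mul_le_mul hθ.2 ((KerrPeel.norm_tn_le v).trans hvK) (norm_nonneg _) hℓ0.le
        _ = ρ / 2 := hℓCw
    have hdist : dist (KerrPeel.tn (p + θ • v)) (KerrPeel.tn p) < ρ := by
      rw [KerrPeel.tn_add_smul, dist_eq_norm, add_sub_cancel_left, norm_smul, Real.norm_eq_abs,
        abs_of_nonneg hθ.1]
      linarith
    have hnz : ‖KerrPeel.tn (p + θ • v)‖ ≤ RK + 1 := by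
      rw [KerrPeel.tn_add_smul]
      calc ‖KerrPeel.tn p + θ • KerrPeel.tn v‖ ≤ ‖KerrPeel.tn p‖ + ‖θ • KerrPeel.tn v‖ := norm_add_le _ _
        _ ≤ RK + 1 := by
            rw [norm_smul, Real.norm_eq_abs, abs_of_nonneg hθ.1]
            linarith
    have hz_ball : KerrPeel.tn (p + θ • v) ∈ closedBall (0 : E4) (RK + 1) := mem_closedBall_zero_iff.2 hnz
    have hr := hρ₀' (KerrPeel.tn (p + θ • v)) hz_ball (KerrPeel.tn p) hp_ball (hdist.trans_le hρρ₀)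
    rw [Real.dist_eq, KerrPeel.radius_tn, KerrPeel.radius_tn] at hr
    have hr' := (abs_lt.1 hr).1
    refine ⟨⟨hz_ball, ?_⟩, hdist⟩
    show Kerr.rPlus M a + δ / 2 ≤ Kerr.radius a (KerrPeel.tn (p + θ • v))
    rw [KerrPeel.radius_tn]
    linarith
  -- pointwise facts along the segment
  have facts : ∀ θ ∈ Icc (0 : ℝ) ℓ, 0 < Kerr.radius a (p + θ • v) ∧
      Kerr.bilin M a (p + θ • v) v v ≤ -(m₀' / 2) ∧
      c₁' / 2 ≤ Kerr.bilin M a (p + θ • v) (Kerr.radiusGradVector M a (p + θ • v)) v := by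
    intro θ hθ
    obtain ⟨hzK', hdist⟩ := seg θ hθ
    have hzpos : 0 < Kerr.radius a (p + θ • v) := by
      have h := hK'pos _ hzK'
      rwa [KerrPeel.radius_tn] at h
    refine ⟨hzpos, ?_, ?_⟩
    · have hG := hρ₁' (KerrPeel.tn (p + θ • v)) hzK' (KerrPeel.tn p) hpK' (hdist.trans_le hρρ₁)
      rw [dist_eq_norm, KerrPeel.bilin_tn, KerrPeel.bilin_tn] at hG
      have h1 := KerrPeel.bilin_sub_apply_le (Kerr.bilin M a (p + θ • v)) (Kerr.bilin M a p) v v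
      have h2 : ‖Kerr.bilin M a (p + θ • v) - Kerr.bilin M a p‖ * ‖v‖ * ‖v‖ ≤
          m₀' / (2 * Cw ^ 2) * Cw * Cw := by
        have := norm_nonneg v
        apply mul_le_mul (mul_le_mul hG.le hvK this (by positivity)) hvK this (by positivity)
      have h3 : m₀' / (2 * Cw ^ 2) * Cw * Cw = m₀' / 2 := by
        field_simp
      have h4 : Kerr.bilin M a p v v ≤ -m₀' := hb1
      linarith
    · have hF := hρ₂' (KerrPeel.tn (p + θ • v)) hzK' (KerrPeel.tn p) hpK' (hdist.trans_le hρρ₂)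
      rw [dist_eq_norm, KerrPeel.bilin_tn, KerrPeel.bilin_tn, KerrPeel.radiusGradVector_tn, KerrPeel.radiusGradVector_tn] at hF
      have h1 := (KerrPeel.form_sub_apply_le (Kerr.bilin M a (p + θ • v) (Kerr.radiusGradVector M a (p + θ • v)))
        (Kerr.bilin M a p (Kerr.radiusGradVector M a p)) v).1
      have h2 : ‖Kerr.bilin M a (p + θ • v) (Kerr.radiusGradVector M a (p + θ • v)) -
          Kerr.bilin M a p (Kerr.radiusGradVector M a p)‖ * ‖v‖ ≤ c₁' / (2 * Cw) * Cw :=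
        mul_le_mul hF.le hvK (norm_nonneg v) (by positivity)
      have h3 : c₁' / (2 * Cw) * Cw = c₁' / 2 := by
        field_simp
      have h4 : c₁' ≤ Kerr.bilin M a p (Kerr.radiusGradVector M a p) v := hb2
      linarith
  refine ⟨hvK, hVK, hb3, hv0, hb4, hVw, fun θ hθ => ⟨(facts θ hθ).1, (facts θ hθ).2.1⟩, ?_⟩
  -- radius growth: mean value theorem for `θ ↦ r(p + θ v)`
  have hderiv : ∀ θ ∈ Icc (0 : ℝ) ℓ, HasDerivAt (fun θ : ℝ => Kerr.radius a (p + θ • v))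
      (Kerr.bilin M a (p + θ • v) (Kerr.radiusGradVector M a (p + θ • v)) v) θ := by
    intro θ hθ
    have hF := Kerr.hasFDerivAt_radius_bilin (M := M) (facts θ hθ).1
    have hline : HasDerivAt (fun s : ℝ => p + s • v) v θ := by
      simpa using ((hasDerivAt_id θ).smul_const v).const_add p
    exact hF.comp_hasDerivAt θ hline
  have hcont : ContinuousOn (fun θ : ℝ => Kerr.radius a (p + θ • v)) (Icc 0 ℓ) := by
    have : Continuous fun θ : ℝ => p + θ • v := by fun_prop
    exact ((Kerr.continuous_radius a).comp this).continuousOn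
  have hdiff : DifferentiableOn ℝ (fun θ : ℝ => Kerr.radius a (p + θ • v)) (interior (Icc 0 ℓ)) :=
    fun θ hθ => (hderiv θ (interior_subset hθ)).differentiableAt.differentiableWithinAt
  have hge : ∀ θ ∈ interior (Icc (0 : ℝ) ℓ),
      c₁' / 2 ≤ deriv (fun θ : ℝ => Kerr.radius a (p + θ • v)) θ := by
    intro θ hθ
    rw [(hderiv θ (interior_subset hθ)).deriv]
    exact (facts θ (interior_subset hθ)).2.2
  intro θ hθ θ' hθ' hle
  exact (convex_Icc (0 : ℝ) ℓ).mul_sub_le_image_sub_of_le_deriv hcont hdiff hge θ hθ θ' hθ' hle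

/-! ## §6 The chart legs in a time-oriented spacetime -/

/-- The boosted Kerr–Schild background form on boosted vectors is the Kerr–Schild form in the rest frame:
`g_B(x)(Λv, Λw) = g_{M,a}(Λ⁻¹(x − c))(v, w)` (Lorentz covariance of the Kerr–Schild class; cf.
`KerrPeel.boostedKerrBilin_apply_boost` for the unbundled form). [cite: KerrSchild1965] -/
theorem boosted_bilin_apply' (Λ : lorentzGroup) (c : E4) (M a : ℝ) (x v w : E4) :
    (boostedKerrBackground Λ c M a).bilin x ((Λ : E4 ≃L[ℝ] E4) v) ((Λ : E4 ≃L[ℝ] E4) w) =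
      Kerr.bilin M a (poincareInv Λ c x) v w := by
  show boostedKerrBilin Λ c M a x _ _ = _
  rw [boostedKerrBilin_apply, ContinuousLinearEquiv.symm_apply_apply,
    ContinuousLinearEquiv.symm_apply_apply]

/-- Membership in the boosted Kerr exterior `(boostedKerrBackground Λ c M a).domain` from the rest-frame radius
`max r₊ 0 < r(Λ⁻¹(z − c))` (definitional). [cite: KerrSchild1965] -/
theorem bkb_mem_domain {Λ : lorentzGroup} {c : E4} {M a : ℝ} {z : E4}
    (h : max (Kerr.rPlus M a) 0 < Kerr.radius a (poincareInv Λ c z)) :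
    z ∈ ((boostedKerrBackground Λ c M a).domain : Set E4) := h

section Chart

variable (𝓢 : Spacetime.{0} 4)

set_option maxHeartbeats 400000 in
/-- **Outgoing escape in a time-oriented spacetime** (the content of `OutgoingEscape`, for any chart
`Ψ` of any `Spacetime 4` on a boosted Kerr–Schild background). For `M, δ > 0`, `R₀ ≥ r₊ + δ` there
are `ε > 0` and `C` such that: if the metric deviation is `≤ ε` on `{t* ≥ τ₁, r ≤ R₀ + 1}` and `dΨ(ΛV)`
is future-directed there, then every chart point `y` with `t*(y) ≥ τ₁`, `r₊ + δ ≤ r(y) ≤ R₀` is joined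
by a future causal curve to a chart point `x` with `r(x) = R₀`, `t*(y) ≤ t*(x) ≤ t*(y) + C`.
O'Neill 1983, Ch. 5, Lemma 5.26, 5.29; Ch. 14, p. 402; Dafermos–Rodnianski arXiv:0811.0354, §5.1. [cite: arXiv08110354, §5.1] -/
theorem outgoingEscape_spacetime (Λ : lorentzGroup) (c : E4) {M : ℝ} (a : ℝ) (hM : 0 < M)
    {δ : ℝ} (hδ : 0 < δ) {R₀ : ℝ} (hR₀ : Kerr.rPlus M a + δ ≤ R₀) :
    ∃ ε : ℝ, 0 < ε ∧ ∃ C : ℝ,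
    ∀ Ψ : (boostedKerrBackground Λ c M a).domain → 𝓢.carrier,
      ContMDiff 𝓘(ℝ, E4) (𝓡 4) ((⊤ : ℕ∞) : WithTop ℕ∞) Ψ →
    ∀ τ₁ : ℝ,
    (∀ x : (boostedKerrBackground Λ c M a).domain, τ₁ ≤ (boostedKerrBackground Λ c M a).time x.1 →
      (boostedKerrBackground Λ c M a).radius x.1 ≤ R₀ + 1 →
      ‖𝓢.deviation (boostedKerrBackground Λ c M a) Ψ x‖ ≤ ε) →
    (∀ x : (boostedKerrBackground Λ c M a).domain, τ₁ ≤ (boostedKerrBackground Λ c M a).time x.1 →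
      (boostedKerrBackground Λ c M a).radius x.1 ≤ R₀ + 1 →
      𝓢.timeOrientation.IsFutureDirected
        (mfderiv 𝓘(ℝ, E4) (𝓡 4) Ψ x ((Λ : E4 ≃L[ℝ] E4) (Kerr.timeVector M a (poincareInv Λ c x.1))))) →
    ∀ y : (boostedKerrBackground Λ c M a).domain, τ₁ ≤ (boostedKerrBackground Λ c M a).time y.1 →
      Kerr.rPlus M a + δ ≤ (boostedKerrBackground Λ c M a).radius y.1 →
      (boostedKerrBackground Λ c M a).radius y.1 ≤ R₀ →
      ∃ x : (boostedKerrBackground Λ c M a).domain, (boostedKerrBackground Λ c M a).radius x.1 = R₀ ∧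
        (boostedKerrBackground Λ c M a).time y.1 ≤ (boostedKerrBackground Λ c M a).time x.1 ∧
        (boostedKerrBackground Λ c M a).time x.1 ≤ (boostedKerrBackground Λ c M a).time y.1 + C ∧
        Ψ x ∈ 𝓢.metric.causalFuture 𝓢.timeOrientation {Ψ y} := by
  obtain ⟨m₀, m₂, c₁, Cw, CV, ℓ, hm₀, hm₂, hc₁, hCw, hCV, hℓ, hpack⟩ := rest_package hM a hδ hR₀
  have hCw0 : 0 < Cw := lt_of_lt_of_le one_pos hCw
  have hCV0 : 0 < CV := lt_of_lt_of_le one_pos hCV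
  obtain ⟨KΛ, hKΛ⟩ : ∃ K : ℝ, ‖((Λ : E4 ≃L[ℝ] E4) : E4 →L[ℝ] E4)‖ = K := ⟨_, rfl⟩
  have hK1 : 1 ≤ KΛ := by rw [← hKΛ]; exact BoostedKerrLegs.one_le_norm_lorentz Λ
  have hK0 : 0 < KΛ := lt_of_lt_of_le one_pos hK1
  have hΛle : ∀ v : E4, ‖(Λ : E4 ≃L[ℝ] E4) v‖ ≤ KΛ * ‖v‖ := fun v => by
    rw [← hKΛ]
    exact ((Λ : E4 ≃L[ℝ] E4) : E4 →L[ℝ] E4).le_opNorm v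
  -- the deviation threshold `ε`
  obtain ⟨ε, hεdef⟩ : ∃ ε : ℝ, ε = min (m₀ / (2 * KΛ ^ 2 * Cw ^ 2))
      (min (m₂ / (2 * KΛ ^ 2 * CV * Cw)) (1 / (2 * KΛ ^ 2 * CV ^ 2))) := ⟨_, rfl⟩
  have hε0 : 0 < ε := by rw [hεdef]; positivity
  have hε1 : ε ≤ m₀ / (2 * KΛ ^ 2 * Cw ^ 2) := by rw [hεdef]; exact min_le_left _ _
  have hε2 : ε ≤ m₂ / (2 * KΛ ^ 2 * CV * Cw) := by
    rw [hεdef]; exact (min_le_right _ _).trans (min_le_left _ _)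
  have hε3 : ε ≤ 1 / (2 * KΛ ^ 2 * CV ^ 2) := by
    rw [hεdef]; exact (min_le_right _ _).trans (min_le_right _ _)
  have hεu : ∀ v : E4, ‖v‖ ≤ Cw →
      ε * ‖(Λ : E4 ≃L[ℝ] E4) v‖ * ‖(Λ : E4 ≃L[ℝ] E4) v‖ ≤ m₀ / 2 := by
    intro v hv
    have h1 : ‖(Λ : E4 ≃L[ℝ] E4) v‖ ≤ KΛ * Cw := (hΛle v).trans (mul_le_mul_of_nonneg_left hv hK0.le)
    have h0 := norm_nonneg ((Λ : E4 ≃L[ℝ] E4) v)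
    calc ε * ‖(Λ : E4 ≃L[ℝ] E4) v‖ * ‖(Λ : E4 ≃L[ℝ] E4) v‖
        ≤ (m₀ / (2 * KΛ ^ 2 * Cw ^ 2)) * (KΛ * Cw) * (KΛ * Cw) :=
          mul_le_mul (mul_le_mul hε1 h1 h0 (by positivity)) h1 h0 (by positivity)
      _ = m₀ / 2 := by field_simp
  have hεVu : ∀ v : E4, ‖v‖ ≤ Cw → ∀ V : E4, ‖V‖ ≤ CV →
      ε * ‖(Λ : E4 ≃L[ℝ] E4) V‖ * ‖(Λ : E4 ≃L[ℝ] E4) v‖ ≤ m₂ / 2 := by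
    intro v hv V hV
    have h1 : ‖(Λ : E4 ≃L[ℝ] E4) v‖ ≤ KΛ * Cw := (hΛle v).trans (mul_le_mul_of_nonneg_left hv hK0.le)
    have h2 : ‖(Λ : E4 ≃L[ℝ] E4) V‖ ≤ KΛ * CV := (hΛle V).trans (mul_le_mul_of_nonneg_left hV hK0.le)
    have h0 := norm_nonneg ((Λ : E4 ≃L[ℝ] E4) v)
    have h0' := norm_nonneg ((Λ : E4 ≃L[ℝ] E4) V)
    calc ε * ‖(Λ : E4 ≃L[ℝ] E4) V‖ * ‖(Λ : E4 ≃L[ℝ] E4) v‖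
        ≤ (m₂ / (2 * KΛ ^ 2 * CV * Cw)) * (KΛ * CV) * (KΛ * Cw) :=
          mul_le_mul (mul_le_mul hε2 h2 h0' (by positivity)) h1 h0 (by positivity)
      _ = m₂ / 2 := by field_simp
  have hεVV : ∀ V : E4, ‖V‖ ≤ CV →
      ε * ‖(Λ : E4 ≃L[ℝ] E4) V‖ * ‖(Λ : E4 ≃L[ℝ] E4) V‖ ≤ 1 / 2 := by
    intro V hV
    have h2 : ‖(Λ : E4 ≃L[ℝ] E4) V‖ ≤ KΛ * CV := (hΛle V).trans (mul_le_mul_of_nonneg_left hV hK0.le)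
    have h0' := norm_nonneg ((Λ : E4 ≃L[ℝ] E4) V)
    calc ε * ‖(Λ : E4 ≃L[ℝ] E4) V‖ * ‖(Λ : E4 ≃L[ℝ] E4) V‖
        ≤ (1 / (2 * KΛ ^ 2 * CV ^ 2)) * (KΛ * CV) * (KΛ * CV) :=
          mul_le_mul (mul_le_mul hε3 h2 h0' (by positivity)) h2 h0' (by positivity)
      _ = 1 / 2 := by field_simp
  -- number of steps and the time bound `C`
  have hη : 0 < c₁ * ℓ := mul_pos hc₁ hℓ
  obtain ⟨N, hN⟩ := exists_nat_ge ((R₀ - (Kerr.rPlus M a + δ)) / (c₁ * ℓ))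
  refine ⟨ε, hε0, (N + 1) * (ℓ * Cw), ?_⟩
  intro Ψ hΨ τ₁ hdev hfd
  /- ONE STEP: from a chart point `p` of the shell, a frozen-direction segment along `Λ w(p')`,
  cut at `r = R₀`, with timelike future-directed velocities. -/
  have step : ∀ p : (boostedKerrBackground Λ c M a).domain,
      τ₁ ≤ (boostedKerrBackground Λ c M a).time p.1 →
      Kerr.rPlus M a + δ ≤ (boostedKerrBackground Λ c M a).radius p.1 →
      (boostedKerrBackground Λ c M a).radius p.1 ≤ R₀ →
      ∃ q : (boostedKerrBackground Λ c M a).domain,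
        Ψ q ∈ 𝓢.metric.causalFuture 𝓢.timeOrientation {Ψ p} ∧
        (boostedKerrBackground Λ c M a).time p.1 ≤ (boostedKerrBackground Λ c M a).time q.1 ∧
        (boostedKerrBackground Λ c M a).time q.1 ≤ (boostedKerrBackground Λ c M a).time p.1 + ℓ * Cw ∧
        Kerr.rPlus M a + δ ≤ (boostedKerrBackground Λ c M a).radius q.1 ∧
        (boostedKerrBackground Λ c M a).radius q.1 ≤ R₀ ∧
        ((boostedKerrBackground Λ c M a).radius q.1 = R₀ ∨
          (boostedKerrBackground Λ c M a).radius p.1 + c₁ * ℓ ≤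
            (boostedKerrBackground Λ c M a).radius q.1) := by
    intro p hp0 hp1 hp2
    -- rest-frame point, escape vector, lab direction
    obtain ⟨p', hp'⟩ : ∃ p' : E4, poincareInv Λ c p.1 = p' := ⟨_, rfl⟩
    have hp0' : τ₁ ≤ p' 0 := by rw [← hp']; exact hp0
    have hp1' : Kerr.rPlus M a + δ ≤ Kerr.radius a p' := by rw [← hp']; exact hp1
    have hp2' : Kerr.radius a p' ≤ R₀ := by rw [← hp']; exact hp2
    obtain ⟨hvK, hVK, hv0lo, hv0hi, hVV, hVw, hseg, hgrow⟩ := hpack p' hp1' hp2'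
    obtain ⟨v, hv⟩ : ∃ v : E4, escapeVector M a p' = v := ⟨_, rfl⟩
    rw [hv] at hvK hv0lo hv0hi hVw hseg hgrow
    obtain ⟨u, hu⟩ : ∃ u : E4, (Λ : E4 ≃L[ℝ] E4) v = u := ⟨_, rfl⟩
    have hnu : ε * ‖u‖ * ‖u‖ ≤ m₀ / 2 := by rw [← hu]; exact hεu v hvK
    have hnVu : ε * ‖(Λ : E4 ≃L[ℝ] E4) (Kerr.timeVector M a p')‖ * ‖u‖ ≤ m₂ / 2 := by
      rw [← hu]; exact hεVu v hvK _ hVK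
    have hnVV : ε * ‖(Λ : E4 ≃L[ℝ] E4) (Kerr.timeVector M a p')‖ *
        ‖(Λ : E4 ≃L[ℝ] E4) (Kerr.timeVector M a p')‖ ≤ 1 / 2 := hεVV _ hVK
    -- rest coordinates, background form, time and radius along the lab segment `p + θu`
    have hrest : ∀ θ : ℝ, poincareInv Λ c (p.1 + θ • u) = p' + θ • v := fun θ => by
      rw [← hu, KerrPeel.poincareInv_add_smul, hp']
    have hBuu : ∀ θ : ℝ, (boostedKerrBackground Λ c M a).bilin (p.1 + θ • u) u u =
        Kerr.bilin M a (p' + θ • v) v v := fun θ => by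
      rw [← hu, boosted_bilin_apply', KerrPeel.poincareInv_add_smul, hp']
    have htime_eq : ∀ θ : ℝ, (boostedKerrBackground Λ c M a).time (p.1 + θ • u) = p' 0 + θ * v 0 := by
      intro θ
      show poincareInv Λ c (p.1 + θ • u) 0 = _
      rw [hrest]
      simp only [PiLp.add_apply, PiLp.smul_apply, smul_eq_mul]
    have hradB : ∀ θ : ℝ, (boostedKerrBackground Λ c M a).radius (p.1 + θ • u) =
        Kerr.radius a (p' + θ • v) := by
      intro θ
      show Kerr.radius a (poincareInv Λ c (p.1 + θ • u)) = _
      rw [hrest]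
    -- the cut parameter `θs`: first (any) crossing of `r = R₀`, else the full step `ℓ`
    have hcont : ContinuousOn (fun θ : ℝ => Kerr.radius a (p' + θ • v)) (Icc 0 ℓ) := by
      have : Continuous fun θ : ℝ => p' + θ • v := by fun_prop
      exact ((Kerr.continuous_radius a).comp this).continuousOn
    have hθs : ∃ θs ∈ Icc (0 : ℝ) ℓ, Kerr.radius a (p' + θs • v) ≤ R₀ ∧
        (Kerr.radius a (p' + θs • v) = R₀ ∨ (θs = ℓ ∧ Kerr.radius a (p' + ℓ • v) < R₀)) := by
      by_cases h : R₀ ≤ Kerr.radius a (p' + ℓ • v)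
      · have h0 : (fun θ : ℝ => Kerr.radius a (p' + θ • v)) 0 ≤ R₀ := by simpa using hp2'
        obtain ⟨θs, hθs, hφθs⟩ := intermediate_value_Icc hℓ.le hcont ⟨h0, h⟩
        exact ⟨θs, hθs, le_of_eq hφθs, Or.inl hφθs⟩
      · have h' : Kerr.radius a (p' + ℓ • v) < R₀ := lt_of_not_ge h
        exact ⟨ℓ, ⟨hℓ.le, le_rfl⟩, h'.le, Or.inr ⟨rfl, h'⟩⟩
    obtain ⟨θs, hθs, hφle, halt⟩ := hθs
    have hIcc : ∀ θ ∈ Icc (0 : ℝ) θs, θ ∈ Icc (0 : ℝ) ℓ := fun θ hθ => ⟨hθ.1, hθ.2.trans hθs.2⟩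
    have hrad_ge : ∀ θ ∈ Icc (0 : ℝ) θs, Kerr.radius a p' ≤ Kerr.radius a (p' + θ • v) := by
      intro θ hθ
      have h := hgrow 0 ⟨le_rfl, hℓ.le⟩ θ (hIcc θ hθ) hθ.1
      rw [zero_smul, add_zero, sub_zero] at h
      have h' : 0 ≤ c₁ * θ := mul_nonneg hc₁.le hθ.1
      linarith
    have hrad_le : ∀ θ ∈ Icc (0 : ℝ) θs, Kerr.radius a (p' + θ • v) ≤ R₀ := by
      intro θ hθ
      have h := hgrow θ (hIcc θ hθ) θs hθs hθ.2
      have h' : 0 ≤ c₁ * (θs - θ) := mul_nonneg hc₁.le (by linarith [hθ.2])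
      linarith
    have hdom : ∀ θ ∈ Icc (0 : ℝ) θs,
        p.1 + θ • u ∈ ((boostedKerrBackground Λ c M a).domain : Set E4) := by
      intro θ hθ
      apply bkb_mem_domain
      rw [hrest]
      exact max_rPlus_lt_of_le hM hδ (hp1'.trans (hrad_ge θ hθ))
    have htime_ge : ∀ θ ∈ Icc (0 : ℝ) θs, τ₁ ≤ (boostedKerrBackground Λ c M a).time (p.1 + θ • u) := by
      intro θ hθ
      rw [htime_eq]
      have h' : 0 ≤ θ * v 0 := mul_nonneg hθ.1 (by linarith)
      linarith
    have hradB_le : ∀ θ ∈ Icc (0 : ℝ) θs,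
        (boostedKerrBackground Λ c M a).radius (p.1 + θ • u) ≤ R₀ + 1 := by
      intro θ hθ
      rw [hradB]
      linarith [hrad_le θ hθ]
    -- causal (indeed timelike) velocities along the segment
    have hcausal : ∀ θ ∈ Icc (0 : ℝ) θs,
        ∀ h : p.1 + θ • u ∈ ((boostedKerrBackground Λ c M a).domain : Set E4),
        𝓢.metric.IsCausal (mfderiv 𝓘(ℝ, E4) (𝓡 4) Ψ ⟨p.1 + θ • u, h⟩ u) := by
      intro θ hθ h
      have hd := hdev ⟨p.1 + θ • u, h⟩ (htime_ge θ hθ) (hradB_le θ hθ)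
      have h1 := KerrPeel.val_mfderiv_le 𝓢 (boostedKerrBackground Λ c M a) Ψ ⟨p.1 + θ • u, h⟩ hd u u
      have h2 : (boostedKerrBackground Λ c M a).bilin
          (⟨p.1 + θ • u, h⟩ : (boostedKerrBackground Λ c M a).domain).1 u u =
          Kerr.bilin M a (p' + θ • v) v v := hBuu θ
      rw [h2] at h1
      have h3 := (hseg θ (hIcc θ hθ)).2
      have hlt : 𝓢.metric.val (Ψ ⟨p.1 + θ • u, h⟩) (mfderiv 𝓘(ℝ, E4) (𝓡 4) Ψ ⟨p.1 + θ • u, h⟩ u)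
          (mfderiv 𝓘(ℝ, E4) (𝓡 4) Ψ ⟨p.1 + θ • u, h⟩ u) < 0 := by linarith
      exact ⟨hlt.le, fun h0 => by rw [h0] at hlt; simp at hlt⟩
    -- future-directedness at the start of the segment (same cone as `dΨ(ΛV)`)
    have hfd0 : 𝓢.timeOrientation.IsFutureDirected (mfderiv 𝓘(ℝ, E4) (𝓡 4) Ψ p u) := by
      have hR1 : (boostedKerrBackground Λ c M a).radius p.1 ≤ R₀ + 1 := by
        have : (boostedKerrBackground Λ c M a).radius p.1 ≤ R₀ := hp2
        linarith
      have hV := hfd p hp0 hR1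
      rw [hp'] at hV
      have hd := hdev p hp0 hR1
      have h1 := KerrPeel.val_mfderiv_le 𝓢 (boostedKerrBackground Λ c M a) Ψ p hd
        ((Λ : E4 ≃L[ℝ] E4) (Kerr.timeVector M a p')) ((Λ : E4 ≃L[ℝ] E4) (Kerr.timeVector M a p'))
      have h2 := KerrPeel.val_mfderiv_le 𝓢 (boostedKerrBackground Λ c M a) Ψ p hd
        ((Λ : E4 ≃L[ℝ] E4) (Kerr.timeVector M a p')) u
      have h3 := KerrPeel.val_mfderiv_le 𝓢 (boostedKerrBackground Λ c M a) Ψ p hd u u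
      rw [boosted_bilin_apply', hp'] at h1
      rw [← hu, boosted_bilin_apply', hp', hu] at h2
      rw [← hu, boosted_bilin_apply', hp', hu] at h3
      have hvv : Kerr.bilin M a p' v v ≤ -m₀ := by
        have h := (hseg 0 ⟨le_rfl, hℓ.le⟩).2
        rwa [zero_smul, add_zero] at h
      have hVt : 𝓢.metric.IsTimelike
          (mfderiv 𝓘(ℝ, E4) (𝓡 4) Ψ p ((Λ : E4 ≃L[ℝ] E4) (Kerr.timeVector M a p'))) := by
        show 𝓢.metric.val _ _ _ < 0
        linarith
      have huc : 𝓢.metric.IsCausal (mfderiv 𝓘(ℝ, E4) (𝓡 4) Ψ p u) := by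
        have hlt : 𝓢.metric.val (Ψ p) (mfderiv 𝓘(ℝ, E4) (𝓡 4) Ψ p u)
            (mfderiv 𝓘(ℝ, E4) (𝓡 4) Ψ p u) < 0 := by linarith
        exact ⟨hlt.le, fun h0 => by rw [h0] at hlt; simp at hlt⟩
      have hcross : 𝓢.metric.val (Ψ p)
          (mfderiv 𝓘(ℝ, E4) (𝓡 4) Ψ p ((Λ : E4 ≃L[ℝ] E4) (Kerr.timeVector M a p')))
          (mfderiv 𝓘(ℝ, E4) (𝓡 4) Ψ p u) < 0 := by linarith
      exact 𝓢.timeOrientation.isFutureDirected_of_val_lt_zero hV hVt huc hcross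
    -- conclusion of the step
    rcases eq_or_lt_of_le hθs.1 with h0 | hpos
    · -- degenerate cut `θs = 0`: the point `p` is already on `{r = R₀}`
      have hR : (boostedKerrBackground Λ c M a).radius p.1 = R₀ := by
        rcases halt with h | ⟨h, _⟩
        · rw [← h0, zero_smul, add_zero] at h
          show Kerr.radius a (poincareInv Λ c p.1) = R₀
          rw [hp']
          exact h
        · exfalso
          linarith
      refine ⟨p, LorentzianMetric.subset_causalFuture _ _ _ rfl, le_rfl, ?_, hp1, hp2, Or.inl hR⟩
      have : 0 ≤ ℓ * Cw := by positivity
      linarith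
    · have key := BoostedKerrLegs.leg_two_causal 𝓢 (boostedKerrBackground Λ c M a) Ψ
        (boostedKerrBackground Λ c M a).domain.isOpen (fun _ h => h) hΨ.contMDiffOn p.1 u hpos
        (fun θ hθ => hdom θ hθ) hcausal p.2 (hdom θs ⟨hθs.1, le_rfl⟩) hfd0
      refine ⟨⟨p.1 + θs • u, hdom θs ⟨hθs.1, le_rfl⟩⟩, key, ?_, ?_, ?_, ?_, ?_⟩
      · show poincareInv Λ c p.1 0 ≤ (boostedKerrBackground Λ c M a).time (p.1 + θs • u)
        rw [htime_eq, hp']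
        have h' : 0 ≤ θs * v 0 := mul_nonneg hθs.1 (by linarith)
        linarith
      · show (boostedKerrBackground Λ c M a).time (p.1 + θs • u) ≤ poincareInv Λ c p.1 0 + ℓ * Cw
        rw [htime_eq, hp']
        have : θs * v 0 ≤ ℓ * Cw := mul_le_mul hθs.2 hv0hi (by linarith) hℓ.le
        linarith
      · show Kerr.rPlus M a + δ ≤ (boostedKerrBackground Λ c M a).radius (p.1 + θs • u)
        rw [hradB]
        exact hp1'.trans (hrad_ge θs ⟨hθs.1, le_rfl⟩)
      · show (boostedKerrBackground Λ c M a).radius (p.1 + θs • u) ≤ R₀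
        rw [hradB]
        exact hφle
      · show (boostedKerrBackground Λ c M a).radius (p.1 + θs • u) = R₀ ∨
          Kerr.radius a (poincareInv Λ c p.1) + c₁ * ℓ ≤
            (boostedKerrBackground Λ c M a).radius (p.1 + θs • u)
        rw [hradB, hp']
        rcases halt with h | ⟨hθℓ, _⟩
        · exact Or.inl h
        · right
          rw [hθℓ]
          have h := hgrow 0 ⟨le_rfl, hℓ.le⟩ ℓ ⟨hℓ.le, le_rfl⟩ hℓ.le
          rw [zero_smul, add_zero, sub_zero] at h
          linarith
  /- ITERATION: at most `N + 1` steps reach `{r = R₀}`. -/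
  have iter : ∀ n : ℕ, ∀ p : (boostedKerrBackground Λ c M a).domain,
      τ₁ ≤ (boostedKerrBackground Λ c M a).time p.1 →
      Kerr.rPlus M a + δ ≤ (boostedKerrBackground Λ c M a).radius p.1 →
      (boostedKerrBackground Λ c M a).radius p.1 ≤ R₀ →
      R₀ - n * (c₁ * ℓ) ≤ (boostedKerrBackground Λ c M a).radius p.1 →
      ∃ x : (boostedKerrBackground Λ c M a).domain, (boostedKerrBackground Λ c M a).radius x.1 = R₀ ∧
        (boostedKerrBackground Λ c M a).time p.1 ≤ (boostedKerrBackground Λ c M a).time x.1 ∧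
        (boostedKerrBackground Λ c M a).time x.1 ≤
          (boostedKerrBackground Λ c M a).time p.1 + (n + 1) * (ℓ * Cw) ∧
        Ψ x ∈ 𝓢.metric.causalFuture 𝓢.timeOrientation {Ψ p} := by
    intro n
    induction n with
    | zero =>
      intro p hp0 hp1 hp2 hgap
      refine ⟨p, ?_, le_rfl, ?_, LorentzianMetric.subset_causalFuture _ _ _ rfl⟩
      · simp only [Nat.cast_zero, zero_mul, sub_zero] at hgap
        exact le_antisymm hp2 hgap
      · have : 0 ≤ ℓ * Cw := by positivity
        push_cast
        linarith
    | succ n ih =>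
      intro p hp0 hp1 hp2 hgap
      obtain ⟨q, hJ, ht1, ht2, hq1, hq2, halt⟩ := step p hp0 hp1 hp2
      rcases halt with hhit | hgain
      · refine ⟨q, hhit, ht1, ?_, hJ⟩
        have h1 : (0 : ℝ) ≤ (n + 1) * (ℓ * Cw) := by positivity
        push_cast
        linarith
      · obtain ⟨x, hx, htx1, htx2, hJ'⟩ :=
          ih q (hp0.trans ht1) hq1 hq2 (by push_cast at hgap ⊢; linarith)
        refine ⟨x, hx, ht1.trans htx1, ?_, KerrPeel.mem_causalFuture_trans' 𝓢 hJ hJ'⟩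
        push_cast at htx2 ⊢
        linarith
  -- conclusion
  intro y hy0 hy1 hy2
  have hgap : R₀ - N * (c₁ * ℓ) ≤ (boostedKerrBackground Λ c M a).radius y.1 := by
    have h1 : R₀ - (Kerr.rPlus M a + δ) ≤ N * (c₁ * ℓ) := (div_le_iff₀ hη).1 hN
    linarith
  exact iter N y hy0 hy1 hy2 hgap

end Chart

end KerrEscape

end Literature.Geometry.Lorentzian

end
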